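import Summits.CriticalPhenomena.PercolationContinuityZ3.Theorems.PercNearOneGluingNoHeavyLowerTailForestConnMonotone
import Mathlib.Algebra.Order.BigOperators.Ring.Finset
import Mathlib.Analysis.SpecialFunctions.Pow.Real
import HarnessLib

/-!
# Monotone connection probabilities imply positively correlated connection events — weighted form

Weighted companion of `…ForestConnMonotone` / `…ForestConnMonotoneRelative`: every coordinate `g`
carries an activity `w g ≥ 0` and a member `G` of the pinned family `𝓕(D;K) = {G ⊆ D : P (G ∪ K)}`
has weight `∏_{g ∈ G} w g` (the arboreal gas with arbitrary activities when `P = acyclic`; parallel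
edges of a multigraph = one edge carrying the sum of the activities). Conditioning on a coordinate
`f` splits the partition function as `Z(D;K) = Z(D∖f;K) + w f · Z(D∖f;K∪f)` (`sum_pinned_split`),
and the Harris-type induction of the unit-weight file goes through verbatim
(`sum_mul_sum_inter_ge_of_monotone_on`, relative to an ambient set `E₀`). Specialisation:
`forestsW_conn_posCorr_of_connMonotone_on` — if the connection probabilities of the WEIGHTED
spanning-forest measure of every minor of `E₀` are nondecreasing under pinning an extra edge
(⟺ Semple–Welsh's *independence correlated* = weighted forest negative correlation, on the minors
of `E₀`), then connection events are positively correlated for the weighted measure on every minor: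
`Z[a~b]·Z[c~d] ≤ Z·Z[a~b ∧ c~d]`. This is Theorem A of memo KCLUSTER-gen86 in full (all
activities); by Semple–Welsh (CPC 2008, Thm 4.2/4.4, Prop 3.5/3.7) the hypothesis is a theorem for
series–parallel `E₀` (not formalised here).

Theorems only; no definitions, no `sorry`.
-/

open Finset SimpleGraph

namespace Summit.CriticalPhenomena.PercolationContinuityZ3.Theorems.ConnMonotone

/-! ### §1 Real mixture lemma -/

/-- **Mixture lemma over `ℝ`.** Nonnegative reals with `uᵢ vᵢ ≤ Nᵢ wᵢ`, `uᵢ, vᵢ ≤ Nᵢ`,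
`N₂ u₁ ≤ N₁ u₂`, `N₂ v₁ ≤ N₁ v₂` satisfy `(u₁+u₂)(v₁+v₂) ≤ (N₁+N₂)(w₁+w₂)`. [elementary] -/
theorem mixture_le_real (N₁ N₂ u₁ u₂ v₁ v₂ w₁ w₂ : ℝ) (hN₁ : 0 ≤ N₁) (hN₂ : 0 ≤ N₂)
    (hu₁ : 0 ≤ u₁) (hu₂ : 0 ≤ u₂) (hv₁ : 0 ≤ v₁) (hv₂ : 0 ≤ v₂) (hw₁ : 0 ≤ w₁) (hw₂ : 0 ≤ w₂)
    (h₁ : u₁ * v₁ ≤ N₁ * w₁) (h₂ : u₂ * v₂ ≤ N₂ * w₂) (hu : N₂ * u₁ ≤ N₁ * u₂)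
    (hv : N₂ * v₁ ≤ N₁ * v₂) (bu₁ : u₁ ≤ N₁) (bv₁ : v₁ ≤ N₁) (bu₂ : u₂ ≤ N₂) (bv₂ : v₂ ≤ N₂) :
    (u₁ + u₂) * (v₁ + v₂) ≤ (N₁ + N₂) * (w₁ + w₂) := by
  rcases hN₁.eq_or_lt with h01 | hN₁'
  · have hu₁0 : u₁ = 0 := le_antisymm (h01 ▸ bu₁) hu₁
    have hv₁0 : v₁ = 0 := le_antisymm (h01 ▸ bv₁) hv₁
    subst hu₁0; subst hv₁0; rw [← h01]
    nlinarith [mul_nonneg hN₂ hw₁]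
  rcases hN₂.eq_or_lt with h02 | hN₂'
  · have hu₂0 : u₂ = 0 := le_antisymm (h02 ▸ bu₂) hu₂
    have hv₂0 : v₂ = 0 := le_antisymm (h02 ▸ bv₂) hv₂
    subst hu₂0; subst hv₂0; rw [← h02]
    nlinarith [mul_nonneg hN₁ hw₂]
  have hXY : 0 ≤ (N₁ * u₂ - N₂ * u₁) * (N₁ * v₂ - N₂ * v₁) :=
    mul_nonneg (by linarith) (by linarith)
  have key : (N₁ * N₂) * ((u₁ + u₂) * (v₁ + v₂)) ≤ (N₁ * N₂) * ((N₁ + N₂) * (w₁ + w₂)) := by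
    have e : (N₁ * N₂) * ((N₁ + N₂) * (w₁ + w₂)) - (N₁ * N₂) * ((u₁ + u₂) * (v₁ + v₂))
        = N₂ * (N₁ + N₂) * (N₁ * w₁ - u₁ * v₁) + N₁ * (N₁ + N₂) * (N₂ * w₂ - u₂ * v₂)
          + (N₁ * u₂ - N₂ * u₁) * (N₁ * v₂ - N₂ * v₁) := by ring
    have hA : 0 ≤ N₂ * (N₁ + N₂) * (N₁ * w₁ - u₁ * v₁) := by
      apply mul_nonneg
      · positivity
      · linarith
    have hB : 0 ≤ N₁ * (N₁ + N₂) * (N₂ * w₂ - u₂ * v₂) := by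
      apply mul_nonneg
      · positivity
      · linarith
    linarith
  exact le_of_mul_le_mul_left key (by positivity)

/-! ### §2 Weighted pinned families -/

variable {α : Type*} [DecidableEq α]

/-- **Weighted conditioning on one coordinate.** For `f ∈ D` and weights `w`,
`Σ_{G ⊆ D, Q(G ∪ K)} ∏_{g∈G} w g = Σ_{G ⊆ D∖f, Q(G ∪ K)} ∏ w + w f · Σ_{G ⊆ D∖f, Q(G ∪ (K ∪ f))} ∏ w`.
[elementary] -/
theorem sum_pinned_split (w : α → ℝ) (Q : Finset α → Prop) [DecidablePred Q] (D K : Finset α)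
    {f : α} (hf : f ∈ D) :
    ∑ G ∈ D.powerset.filter (fun G => Q (G ∪ K)), ∏ g ∈ G, w g =
      ∑ G ∈ (D.erase f).powerset.filter (fun G => Q (G ∪ K)), ∏ g ∈ G, w g +
        w f * ∑ G ∈ (D.erase f).powerset.filter (fun G => Q (G ∪ insert f K)), ∏ g ∈ G, w g := by
  rw [← Finset.sum_filter_add_sum_filter_not _ (fun G : Finset α => f ∉ G)]
  congr 1
  · apply Finset.sum_congr _ (fun _ _ => rfl)
    ext G
    simp only [Finset.mem_filter, Finset.mem_powerset]
    constructor
    · rintro ⟨⟨hGD, hQ⟩, hfG⟩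
      exact ⟨fun x hx => Finset.mem_erase.2 ⟨fun h => hfG (h ▸ hx), hGD hx⟩, hQ⟩
    · rintro ⟨hGD, hQ⟩
      exact ⟨⟨fun x hx => (Finset.mem_erase.1 (hGD hx)).2, hQ⟩,
        fun h => (Finset.mem_erase.1 (hGD h)).1 rfl⟩
  · rw [Finset.mul_sum]
    refine Finset.sum_bij' (fun G _ => G.erase f) (fun G _ => insert f G) ?_ ?_ ?_ ?_ ?_
    · intro G hG
      simp only [Finset.mem_filter, Finset.mem_powerset, not_not] at hG ⊢
      obtain ⟨⟨hGD, hQ⟩, hfG⟩ := hG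
      refine ⟨fun x hx => ?_, by rwa [erase_union_insert hfG]⟩
      rcases Finset.mem_erase.1 hx with ⟨hxf, hxG⟩
      exact Finset.mem_erase.2 ⟨hxf, hGD hxG⟩
    · intro G hG
      simp only [Finset.mem_filter, Finset.mem_powerset, not_not] at hG ⊢
      obtain ⟨hGD, hQ⟩ := hG
      refine ⟨⟨?_, ?_⟩, Finset.mem_insert_self _ _⟩
      · intro x hx
        rcases Finset.mem_insert.1 hx with rfl | hx
        · exact hf
        · exact (Finset.mem_erase.1 (hGD hx)).2
      · have : insert f G ∪ K = G ∪ insert f K := by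
          ext x
          simp only [Finset.mem_union, Finset.mem_insert]
          tauto
        rwa [this]
    · intro G hG
      simp only [Finset.mem_filter, not_not] at hG
      exact Finset.insert_erase hG.2
    · intro G hG
      simp only [Finset.mem_filter, Finset.mem_powerset] at hG
      have hfG : f ∉ G := fun h => (Finset.mem_erase.1 (hG.1 h)).1 rfl
      exact Finset.erase_insert hfG
    · intro G hG
      simp only [Finset.mem_filter, not_not] at hG
      rw [← Finset.mul_prod_erase G w hG.2]

/-- Nonnegativity of a pinned partition function for nonnegative activities. [elementary] -/
theorem sum_pinned_nonneg (w : α → ℝ) (hw : ∀ a, 0 ≤ w a) (Q : Finset α → Prop) [DecidablePred Q]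
    (D K : Finset α) :
    0 ≤ ∑ G ∈ D.powerset.filter (fun G => Q (G ∪ K)), ∏ g ∈ G, w g :=
  Finset.sum_nonneg fun _ _ => Finset.prod_nonneg fun g _ => hw g

/-- A pinned partition function restricted to an event is at most the full one (nonnegative
activities). [elementary] -/
theorem sum_pinned_filter_le (w : α → ℝ) (hw : ∀ a, 0 ≤ w a) (P Q : Finset α → Prop)
    [DecidablePred P] [DecidablePred Q] (D K : Finset α) :
    ∑ G ∈ D.powerset.filter (fun G => P (G ∪ K) ∧ Q (G ∪ K)), ∏ g ∈ G, w g ≤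
      ∑ G ∈ D.powerset.filter (fun G => P (G ∪ K)), ∏ g ∈ G, w g :=
  Finset.sum_le_sum_of_subset_of_nonneg
    (fun G hG => by
      simp only [Finset.mem_filter] at hG ⊢
      exact ⟨hG.1, hG.2.1⟩)
    (fun G _ _ => Finset.prod_nonneg fun g _ => hw g)

/-! ### §3 The weighted abstract theorem (relative to an ambient set) -/

/-- **Monotone influences imply positive correlation — weighted, relative to `E₀`.** Activities
`w ≥ 0`; `Z_Q(D;K) := Σ_{G ⊆ D, Q(G∪K)} ∏_{g∈G} w g`. If for all `D ∪ (K ∪ f) ⊆ E₀` (with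
`f ∉ D ∪ K`) both events have nonnegative weighted influence from pinning `f`,
`Z_{P∧U}(D;K)·Z_P(D;K∪f) ≤ Z_{P∧U}(D;K∪f)·Z_P(D;K)` (same for `W`), then for every `D ∪ K ⊆ E₀`,
`D ∩ K = ∅`: `Z_{P∧U}(D;K)·Z_{P∧W}(D;K) ≤ Z_P(D;K)·Z_{P∧U∧W}(D;K)`. [Harris-type induction] -/
theorem sum_mul_sum_inter_ge_of_monotone_on (w : α → ℝ) (hw : ∀ a, 0 ≤ w a) (E₀ : Finset α)
    (P U W : Finset α → Prop) [DecidablePred P] [DecidablePred U] [DecidablePred W]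
    (hU : ∀ (D K : Finset α) (f : α), f ∉ D → f ∉ K → D ∪ insert f K ⊆ E₀ →
      (∑ G ∈ D.powerset.filter (fun G => P (G ∪ K) ∧ U (G ∪ K)), ∏ g ∈ G, w g) *
          (∑ G ∈ D.powerset.filter (fun G => P (G ∪ insert f K)), ∏ g ∈ G, w g) ≤
        (∑ G ∈ D.powerset.filter (fun G => P (G ∪ insert f K) ∧ U (G ∪ insert f K)), ∏ g ∈ G, w g) *
          (∑ G ∈ D.powerset.filter (fun G => P (G ∪ K)), ∏ g ∈ G, w g))
    (hW : ∀ (D K : Finset α) (f : α), f ∉ D → f ∉ K → D ∪ insert f K ⊆ E₀ →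
      (∑ G ∈ D.powerset.filter (fun G => P (G ∪ K) ∧ W (G ∪ K)), ∏ g ∈ G, w g) *
          (∑ G ∈ D.powerset.filter (fun G => P (G ∪ insert f K)), ∏ g ∈ G, w g) ≤
        (∑ G ∈ D.powerset.filter (fun G => P (G ∪ insert f K) ∧ W (G ∪ insert f K)), ∏ g ∈ G, w g) *
          (∑ G ∈ D.powerset.filter (fun G => P (G ∪ K)), ∏ g ∈ G, w g))
    (D K : Finset α) (hDK : Disjoint D K) (hE : D ∪ K ⊆ E₀) :
    (∑ G ∈ D.powerset.filter (fun G => P (G ∪ K) ∧ U (G ∪ K)), ∏ g ∈ G, w g) *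
        (∑ G ∈ D.powerset.filter (fun G => P (G ∪ K) ∧ W (G ∪ K)), ∏ g ∈ G, w g) ≤
      (∑ G ∈ D.powerset.filter (fun G => P (G ∪ K)), ∏ g ∈ G, w g) *
        (∑ G ∈ D.powerset.filter (fun G => P (G ∪ K) ∧ (U (G ∪ K) ∧ W (G ∪ K))), ∏ g ∈ G, w g) := by
  obtain ⟨n, hn⟩ : ∃ n, D.card = n := ⟨_, rfl⟩
  induction n generalizing D K with
  | zero =>
    have hD : D = ∅ := Finset.card_eq_zero.1 hn
    subst hD
    simp only [Finset.powerset_empty, Finset.filter_singleton, Finset.empty_union]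
    by_cases hP : P K <;> by_cases hU' : U K <;> by_cases hW' : W K <;> simp [hP, hU', hW']
  | succ n ih =>
    obtain ⟨f, hf⟩ : D.Nonempty := Finset.card_pos.1 (by omega)
    have hfK : f ∉ K := fun h => Finset.disjoint_left.1 hDK hf h
    have hcard : (D.erase f).card = n := by rw [Finset.card_erase_of_mem hf, hn]; rfl
    have hfD' : f ∉ D.erase f := Finset.notMem_erase f D
    have hdis₁ : Disjoint (D.erase f) K :=
      (Finset.disjoint_of_subset_left (Finset.erase_subset f D) hDK)
    have hdis₂ : Disjoint (D.erase f) (insert f K) := by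
      rw [Finset.disjoint_insert_right]; exact ⟨hfD', hdis₁⟩
    have hE₂ : D.erase f ∪ insert f K ⊆ E₀ := by
      intro x hx
      apply hE
      rcases Finset.mem_union.1 hx with hx | hx
      · exact Finset.mem_union.2 (Or.inl (Finset.mem_of_mem_erase hx))
      · rcases Finset.mem_insert.1 hx with rfl | hx
        · exact Finset.mem_union.2 (Or.inl hf)
        · exact Finset.mem_union.2 (Or.inr hx)
    have hE₁ : D.erase f ∪ K ⊆ E₀ := fun x hx => hE (by
      rcases Finset.mem_union.1 hx with hx | hx
      · exact Finset.mem_union.2 (Or.inl (Finset.mem_of_mem_erase hx))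
      · exact Finset.mem_union.2 (Or.inr hx))
    have sN := sum_pinned_split w (fun X => P X) D K hf
    have sU := sum_pinned_split w (fun X => P X ∧ U X) D K hf
    have sW := sum_pinned_split w (fun X => P X ∧ W X) D K hf
    have sUW := sum_pinned_split w (fun X => P X ∧ (U X ∧ W X)) D K hf
    rw [sN, sU, sW, sUW]
    have ih₁ := ih (D.erase f) K hdis₁ hE₁ hcard
    have ih₂ := ih (D.erase f) (insert f K) hdis₂ hE₂ hcard
    have mU := hU (D.erase f) K f hfD' hfK hE₂
    have mW := hW (D.erase f) K f hfD' hfK hE₂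
    have hwf : 0 ≤ w f := hw f
    -- abbreviate the eight partition functions
    set N₁ := ∑ G ∈ (D.erase f).powerset.filter (fun G => P (G ∪ K)), ∏ g ∈ G, w g with hN₁
    set N₂ := ∑ G ∈ (D.erase f).powerset.filter (fun G => P (G ∪ insert f K)), ∏ g ∈ G, w g
      with hN₂
    set u₁ := ∑ G ∈ (D.erase f).powerset.filter (fun G => P (G ∪ K) ∧ U (G ∪ K)), ∏ g ∈ G, w g
      with hu₁
    set u₂ := ∑ G ∈ (D.erase f).powerset.filter
      (fun G => P (G ∪ insert f K) ∧ U (G ∪ insert f K)), ∏ g ∈ G, w g with hu₂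
    set v₁ := ∑ G ∈ (D.erase f).powerset.filter (fun G => P (G ∪ K) ∧ W (G ∪ K)), ∏ g ∈ G, w g
      with hv₁
    set v₂ := ∑ G ∈ (D.erase f).powerset.filter
      (fun G => P (G ∪ insert f K) ∧ W (G ∪ insert f K)), ∏ g ∈ G, w g with hv₂
    set x₁ := ∑ G ∈ (D.erase f).powerset.filter
      (fun G => P (G ∪ K) ∧ (U (G ∪ K) ∧ W (G ∪ K))), ∏ g ∈ G, w g with hx₁
    set x₂ := ∑ G ∈ (D.erase f).powerset.filter
      (fun G => P (G ∪ insert f K) ∧ (U (G ∪ insert f K) ∧ W (G ∪ insert f K))), ∏ g ∈ G, w g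
      with hx₂
    have n1 : 0 ≤ N₁ := sum_pinned_nonneg w hw _ _ _
    have n2 : 0 ≤ N₂ := sum_pinned_nonneg w hw _ _ _
    have pu₁ : 0 ≤ u₁ := sum_pinned_nonneg w hw (fun X => P X ∧ U X) _ _
    have pu₂ : 0 ≤ u₂ := sum_pinned_nonneg w hw (fun X => P X ∧ U X) _ _
    have pv₁ : 0 ≤ v₁ := sum_pinned_nonneg w hw (fun X => P X ∧ W X) _ _
    have pv₂ : 0 ≤ v₂ := sum_pinned_nonneg w hw (fun X => P X ∧ W X) _ _
    have px₁ : 0 ≤ x₁ := sum_pinned_nonneg w hw (fun X => P X ∧ (U X ∧ W X)) _ _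
    have px₂ : 0 ≤ x₂ := sum_pinned_nonneg w hw (fun X => P X ∧ (U X ∧ W X)) _ _
    have bu₁ : u₁ ≤ N₁ := sum_pinned_filter_le w hw P U _ _
    have bu₂ : u₂ ≤ N₂ := sum_pinned_filter_le w hw P U _ _
    have bv₁ : v₁ ≤ N₁ := sum_pinned_filter_le w hw P W _ _
    have bv₂ : v₂ ≤ N₂ := sum_pinned_filter_le w hw P W _ _
    -- population 2 scaled by the activity `w f`
    have key := mixture_le_real N₁ (w f * N₂) u₁ (w f * u₂) v₁ (w f * v₂) x₁ (w f * x₂)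
      n1 (mul_nonneg hwf n2) pu₁ (mul_nonneg hwf pu₂) pv₁ (mul_nonneg hwf pv₂) px₁
      (mul_nonneg hwf px₂) ih₁ (by nlinarith [ih₂, mul_nonneg hwf hwf])
      (by nlinarith [mU]) (by nlinarith [mW]) bu₁ bv₁
      (mul_le_mul_of_nonneg_left bu₂ hwf) (mul_le_mul_of_nonneg_left bv₂ hwf)
    linarith [key]

/-! ### §4 Weighted spanning forests (arboreal gas with activities) -/

section ForestsW
open scoped Classical

variable {V : Type*} [DecidableEq V]

/-- **Theorem A, weighted (all activities), relative to an ambient edge system `E₀`.** For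
activities `w ≥ 0` let `Z(D;K)[E] = Σ_{G ⊆ D, ⟨G ∪ K⟩ acyclic, E} ∏_{g∈G} w g` be the weighted
spanning-forest partition function of the minor `⟨D ∪ K⟩/K` restricted to an event. If for every
minor of `E₀` the weighted connection probabilities are nondecreasing under pinning an extra edge,
`Z(D;K)[x~y]·Z(D;K∪f) ≤ Z(D;K∪f)[x~y]·Z(D;K)` (⟺ Semple–Welsh independence-correlation =
weighted forest negative correlation on the minors of `E₀`), then the connection events of the
weighted forest measure of every minor are positively correlated:
`Z[a~b]·Z[c~d] ≤ Z·Z[a~b ∧ c~d]`. [memo KCLUSTER-gen86 Thm A; hypothesis proved for series–parallel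
`E₀` in Semple–Welsh, CPC 2008, Thm 4.2 — not formalised] -/
theorem forestsW_conn_posCorr_of_connMonotone_on (w : Sym2 V → ℝ) (hw : ∀ e, 0 ≤ w e)
    (E₀ : Finset (Sym2 V))
    (hmono : ∀ (D K : Finset (Sym2 V)) (f : Sym2 V) (x y : V), f ∉ D → f ∉ K →
      D ∪ insert f K ⊆ E₀ →
      (∑ G ∈ D.powerset.filter (fun G =>
          (fromEdgeSet ((G ∪ K : Finset (Sym2 V)) : Set (Sym2 V))).IsAcyclic ∧
          (fromEdgeSet ((G ∪ K : Finset (Sym2 V)) : Set (Sym2 V))).Reachable x y), ∏ g ∈ G, w g) *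
        (∑ G ∈ D.powerset.filter (fun G =>
          (fromEdgeSet ((G ∪ insert f K : Finset (Sym2 V)) : Set (Sym2 V))).IsAcyclic), ∏ g ∈ G, w g) ≤
      (∑ G ∈ D.powerset.filter (fun G =>
          (fromEdgeSet ((G ∪ insert f K : Finset (Sym2 V)) : Set (Sym2 V))).IsAcyclic ∧
          (fromEdgeSet ((G ∪ insert f K : Finset (Sym2 V)) : Set (Sym2 V))).Reachable x y),
          ∏ g ∈ G, w g) *
        (∑ G ∈ D.powerset.filter (fun G =>
          (fromEdgeSet ((G ∪ K : Finset (Sym2 V)) : Set (Sym2 V))).IsAcyclic), ∏ g ∈ G, w g))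
    (D K : Finset (Sym2 V)) (hDK : Disjoint D K) (hE : D ∪ K ⊆ E₀) (a b c d : V) :
    (∑ G ∈ D.powerset.filter (fun G =>
        (fromEdgeSet ((G ∪ K : Finset (Sym2 V)) : Set (Sym2 V))).IsAcyclic ∧
        (fromEdgeSet ((G ∪ K : Finset (Sym2 V)) : Set (Sym2 V))).Reachable a b), ∏ g ∈ G, w g) *
      (∑ G ∈ D.powerset.filter (fun G =>
        (fromEdgeSet ((G ∪ K : Finset (Sym2 V)) : Set (Sym2 V))).IsAcyclic ∧
        (fromEdgeSet ((G ∪ K : Finset (Sym2 V)) : Set (Sym2 V))).Reachable c d), ∏ g ∈ G, w g) ≤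
    (∑ G ∈ D.powerset.filter (fun G =>
        (fromEdgeSet ((G ∪ K : Finset (Sym2 V)) : Set (Sym2 V))).IsAcyclic), ∏ g ∈ G, w g) *
      (∑ G ∈ D.powerset.filter (fun G =>
        (fromEdgeSet ((G ∪ K : Finset (Sym2 V)) : Set (Sym2 V))).IsAcyclic ∧
        ((fromEdgeSet ((G ∪ K : Finset (Sym2 V)) : Set (Sym2 V))).Reachable a b ∧
         (fromEdgeSet ((G ∪ K : Finset (Sym2 V)) : Set (Sym2 V))).Reachable c d)), ∏ g ∈ G, w g) :=
  sum_mul_sum_inter_ge_of_monotone_on w hw E₀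
    (fun X => (fromEdgeSet ((X : Finset (Sym2 V)) : Set (Sym2 V))).IsAcyclic)
    (fun X => (fromEdgeSet ((X : Finset (Sym2 V)) : Set (Sym2 V))).Reachable a b)
    (fun X => (fromEdgeSet ((X : Finset (Sym2 V)) : Set (Sym2 V))).Reachable c d)
    (fun D K f hf hfK hE' => hmono D K f a b hf hfK hE')
    (fun D K f hf hfK hE' => hmono D K f c d hf hfK hE') D K hDK hE

end ForestsW

end Summit.CriticalPhenomena.PercolationContinuityZ3.Theorems.ConnMonotone
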